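import Summits.FinalStateConjecture.FinalStateConjecture.Theorems.HawkingExtensionIsKerr.Negative.ConnectedHorizon
import Summits.FinalStateConjecture.FinalStateConjecture.Theorems.HawkingExtensionIsKerr.Negative.HorizonCombination
import Summits.FinalStateConjecture.FinalStateConjecture.Theorems.ZeroEnergyRigidity.Negative.KerrParameterSign
import Summits.FinalStateConjecture.FinalStateConjecture.Theorems.HawkingExtensionIsKerr.Negative.ExtremalKerrAxisCollar

/-!
# Disproof of `HawkingExtensionIsKerr` (crux `stmt-FinalStateConjecture-17840`, route `ZeroEnergyKerrOrBomb`) — findings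

Standing adversary file (cdisprove seat `refuter-cdisprove-stmt-FinalStateConjecture-17840-0`,
cycle 1, 2026-08-17).  Prose lives in docstrings; every `theorem` without `sorry` is kernel-checked
(`lean check` rc 0); `sorry` appears ONLY in § (e) Near-misses, each with its obstruction.

## Findings (index)

* **(F0) Elaborates** (`hawkingExtensionIsKerr_iff_named`, `Iff.rfl`): the served body is the ledger
  signature, with the hypotheses NAMED below (`Vacuum`, `IPlusRegular`, `FuturePresented`,
  `KillingNonvanishing`, simply connected d.o.c., `IsOpen U`, `horizon ⊆ U`, `IsConnected horizon`,
  `CollarSmooth/CollarKilling/CollarCommutes/CollarNonvanishing/CollarTangent/CollarTimelike U K`,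
  `Extends U K`) and conclusion `KerrConclusion` (= the conclusion of `ZeroEnergyRigidity` 10690 and
  `KerrOrBomb` 10689 VERBATIM, so their landed tightness lemmas apply: § (b)).
* **(F1) NO KILL.** No `¬ HawkingExtensionIsKerr` is claimed.  As typed the crux is the smooth
  STATIONARY–AXISYMMETRIC uniqueness theorem in the `I⁺`-regular class — Chruściel–Costa 2008
  Thm 1.3 in the form of its Remark 1.6 / Thm 5.6 ("in space-time dimension four analyticity can be
  replaced by axisymmetry and `I⁺`-regularity", arXiv:0806.0016 p. 4 and §5) — PRECEDED by two
  transcription steps the printed theorem does not contain: (i) from the doc-level commuting Killing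
  pair `(T, K')` to an `ℝ × U(1)` action by isometries of `⟨⟨M_ext⟩⟩` (completeness of `K'` on the
  d.o.c. — Chruściel's sandwich argument, here with anchors in the collar since the d.o.c. is NOT a
  maximal development —, then Beig–Chruściel 1997: `K' − cT` is a rotation, `m_ADM > 0` by the
  positive mass theorem for black holes), and (ii) from the Killing–timelike collar to
  non-degeneracy `κ ≠ 0` of the connected Killing horizon (vacuum near-horizon identity
  `F = ½|h|² − ½ div h`, `∫_{S²} F = 4πχ = 8π > 0`, so a degenerate generator turns spacelike
  somewhere in every neighbourhood of `𝓔⁺` — exactly what the collar forbids; extremal Kerr is the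
  model, § (b)).  Every known exact stationary vacuum solution other than sub-extremal Kerr fails a
  hypothesis (junk survey, `junk_survey`), and the conclusion depends on `𝓑` ALONE (not on `U, K,
  K'`), so junk choices of the collar data cannot refute anything.  A refutation needs a smooth
  stationary-axisymmetric `I⁺`-regular vacuum black hole with connected non-degenerate horizon which
  is not Kerr — excluded in print (Carter–Robinson–Bunting–Mazur–Weinstein + CC08 §5–§6; the
  sharpest printed form is Chruściel–Costa–Heusler 2012 Thm 3.2, arXiv:1205.6112 §3.2.7:
  "stationary, AXISYMMETRIC, asymptotically flat, `I⁺`-regular, electrovacuum ⇒ the d.o.c. is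
  isometric to a Weinstein solution; connected horizon ⇒ Kerr–Newman d.o.c." — NO analyticity and NO
  non-degeneracy hypothesis, so in vacuum the output is Kerr with `|a| ≤ M`, and the crux's collar
  is needed exactly to discard `|a| = M` (F4/F4′); loc. cit. §3.3.1 lists what "axisymmetric" costs
  beyond a doc-level `K'`: "globalize the Killing vector field, prove that its orbits are complete,
  and show that there exists a linear combination of Killing vector fields with periodic orbits and
  an axis of rotation … done in [Chruściel CMP 189 (1997)], assuming analyticity" — here
  globalisation is the HYPOTHESIS `Extends`, and completeness/periodicity/axis are the residual
  transcription work of the line).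
* **(F2) `IsConnected 𝓑.horizon` is LOAD-BEARING — PROVED, LANDED as p134444**
  (`Theorems/HawkingExtensionIsKerr/Negative/ConnectedHorizon.lean`,
  `hawkingExtensionIsKerr_false_without_connectedHorizon`; copy here:
  `false_without_connectedHorizon`): with that single binder deleted the crux is FALSE — witness the
  landed Minkowski presentation `minkowskiBH` (`doc = ℝ⁴`, `𝓔⁺ = ∅`, `I⁺`-regular, vacuum,
  future-presented, simply connected) with the VOID collar `U := ∅`, `K := 0` and the extension
  `K' := ∂ₜ`, `U' := ∅`; the conclusion fails by Sbierski (`not_kerrConclusion_minkowskiBH`).  Lesson: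
  every collar clause quantifies over `U`, `𝓔⁺` or `U ∩ doc` and is therefore VOID when `𝓔⁺ = ∅`; the
  non-emptiness of the horizon enters ONLY through `IsConnected`.
* **(F3) `∀ p ∈ doc, T p ≠ 0` is REDUNDANT — PROVED, LANDED with p134444**
  (`hawkingExtensionIsKerr_iff_without_killingNonvanishing`; copy here: `iff_without_killingNonvanishing`):
  Chruściel–Costa 2008 Cor. 3.8 in `I⁺`-regular form is the tree theorem
  `StationaryAFBlackHole.IsIPlusRegular.killing_ne_zero_of_mem_doc`.  For provers: free; for the
  planner: decoration (kept for byte-identity with stmt-13896).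
* **(F4) The collar's timelike clause is LOAD-BEARING for "SUB-extremal" — tightness PROVED,
  LANDED as p134595** (`Theorems/HawkingExtensionIsKerr/Negative/ExtremalKerrNoCollar.lean`; copies
  here `extremal_equatorial_closed_form`, `no_collar_extremal`): at `a = M` the Hawking field
  `K = T + Φ/(2M)` of the Kerr–Schild chart has `g(K,K) = (r − M)²(r + 2M)/(4M²r) > 0` on the whole
  exterior equator, so DRSR Lemma 4.7.2 (tree: `Kerr.exists_bilin_hawkingVector_neg`, `|a| < M`) is
  FALSE at `(M, M)` and no open `U ⊇ {r = M}` carries `g(K,K) < 0` on `U ∩ {r > M}`.  On a Kerr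
  exterior any Killing `K` tangent to `𝓔⁺` and timelike just outside is `∝ T + ω₊Φ` (the transverse
  part `β'Φ` has `g = β'² g_φφ ≥ 0` ON the horizon), so extremal Kerr admits NO collar `(U, K)` at all:
  the collar is the crux's only guard against the degenerate case, for which the conclusion
  (`|a| < M`) is false on paper.  Any restate weakening `g(K,K) < 0 on U ∩ doc` to "`K` causal" /
  "`K` null non-vanishing on `𝓔⁺`" re-admits extremal Kerr (near-miss `false_without_collarTimelike`,
  § (e): needs extremal Kerr packaged as an `I⁺`-regular `StationaryAFBlackHole` + non-isometry of
  extremal and sub-extremal exteriors — not in the tree).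
* **(F4″) The collar failure at `a = M` is a BAND phenomenon — axis anatomy PROVED, LANDED as
  p134796** (session B of this seat; `Theorems/HawkingExtensionIsKerr/Negative/ExtremalKerrAxisCollar.lean`:
  `bilin_killingSpan_axis`, `bilin_hawkingVector_extremal_axis`, `…_neg`, `…_horizon`; kernel-linked
  copies `killingSpan_axis_closed_form`, `extremal_axis_closed_form`, `extremal_axis_timelike` in
  § (F4″)): on the rotation axis `{x₁ = x₂ = 0}` of the Kerr–Schild chart
  `g_{M,a}(T + cΦ, T + cΦ) = −Δ/(r² + a²)` for ALL real `(M, a, c)` (`Φ = 0` there), so at `a = M`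
  the Hawking field has `g(K, K) = −(r − M)²/(r² + M²) < 0` at every axis point off the horizon: the
  polar caps ARE timelike (near-horizon coefficient `F(0) < 0`) while the equator is spacelike
  (`F(π/2) > 0`, F4) — the two endpoints of the band `sin θ > √3 − 1` in closed form.  Reading: the
  load-bearing collar clause is tight at `a = M` only OFF-axis; an argument (or a restate) that tests
  the generator along the axis only, or only through the section average `∫_S F dA = 8π`, must still
  localise `{F > 0}` (cards `degenerate-horizon-gauss-bonnet`, `degenerate-collar-gauss-law`).
  Numerics of the route text re-checked (session B, plain quadrature): `δ₀(0.9) = 0.6435 M`,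
  `δ₀(0.99) = 0.1207 M`, `δ₀(0.999) = 0.0323 M`, `δ₀(0.5) > 3 M`, band onset `47.06°`.
* **(F4′) The collar PINS the horizon generator — PROVED, LANDED as p135001**
  (`Theorems/HawkingExtensionIsKerr/Negative/HorizonCombination.lean`): ON the horizon `{r = r₊}` of
  the Kerr–Schild chart, for all `|a| ≤ M`, `M > 0`, `c ∈ ℝ`,
  `g(T + cΦ, T + cΦ) = σ (c(r₊² + a²) − a)²/ρ² ≥ 0` (`σ = sin²θ`), positive off the axis unless
  `c = ω₊ = a/(r₊² + a²)`; hence `T + cΦ` has no radial timelike collar for `c ≠ ω₊`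
  (`not_exists_collar_of_ne_horizonAngularVelocity`) and at `a = M` NO `c` works
  (`not_exists_collar_extremal`).  So among the constant combinations `αT + βΦ` (= all Killing
  fields of a Kerr exterior, tree `Kerr.killingField_eq_combination` for `0 < |a| < M`) the collar
  clause singles out the null generator, and at `a = M` it admits none: sub-extremal ⇔ collar.
* **(F5) Typing remarks (no falsity, information for provers/planner).**
  (i) `CollarTangent` is stated through GLOBAL integral curves `γ : ℝ → M` of the global section `K`,
  which is smooth on `U` only: it constrains only those `K`-orbits from `𝓔⁺` that exist for all time
  (e.g. stay in `U`); a prover who needs "`K` is null and tangent on `𝓔⁺`" must DERIVE causality of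
  `K` on `𝓔⁺ = ∂doc` from `CollarTimelike` by continuity and nullity/tangency from the causal
  structure (`I⁺(p) ⊆ 𝓑 ∖ I⁻(M_ext)` for `p ∈ 𝓔⁺`), not read it off `CollarTangent`.
  (ii) `Extends` gives `K'` on `doc` only: NO completeness, NO periodicity, NO relation to `𝓔⁺` beyond
  `K' = K` on `U' ∩ doc`; the vendored `ChruscielCostaHeusler2012_axisymmetricUniqueness` wants a
  carrier-complete `2π`-periodic axial field — the line must produce it at doc level (card
  `horizon-anchored-causal-sandwich`, stubs `CollarSandwich`/`KillingSandwichCompleteness`, both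
  plausible: no cheap kill found, see `pretriage_ideator_stubs`).  LITERATURE NOTE (read for
  this file): Beig–Chruściel CMP 188 (1997) = gr-qc/9610034, Thm 1.1–1.2, classify `G₀` only for a
  genuine group ACTION (complete orbits) on a space-time with an AF boost-type domain, timelike
  `p^μ`, `G_{μν} = O(r^{−3−ε})`; p. 4: "in stationary space-times with more than one Killing vector
  all the results … can be proved directly by an analysis of initial data sets [Beig–Chruściel,
  KIDs, CQG 14 (1997) A83]" — that KID version is the one a doc-level line should vendor
  (asymptotics of `K' − cT` from the slice data of `IsIPlusRegular`'s hypersurface), leaving only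
  COMPLETENESS + PERIODICITY of the rotation's orbits inside the d.o.c. to the sandwich argument.
  (iii) `FuturePresented` is possibly unnecessary for THIS crux (it makes `∂doc = 𝓔⁺`; Kruskal-type
  presentations with a white-hole region keep the conclusion); `SimplyConnectedSpace doc` is
  redundant ON PAPER (topological censorship, Chruściel–Wald 1994, from GH of the d.o.c. + NEC + AF;
  no tree proof).  (iv) `T` is not normalised (`g(T,T) → −1` nowhere stated): the structure admits
  `killing = c • T`, `c > 0`, with the same `M_ext`, doc, horizon (landed `StationaryFieldRescaling`),
  and `[cT, K] = 0`, so every hypothesis here is rescaling-invariant; numbers such as `Ω_H`, `κ` of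
  `K = T + Ω_H Φ` are meaningless before normalising `T` by the AF decay of the slice data.
  (v) `Kerr.Facts` is a theorem (`kerrFacts`) and `HasLeviCivita` is dischargeable
  (`PseudoRiemannianMetric.hasLeviCivita`): neither instance binder protects the crux.
* **(b) Tightness of the conclusion** (inherited, kernel-linked here): the spin sign is free
  (`kerrConclusion_iff_nonneg_spin`, from landed `KerrParameterSign`); the isometry `Ψ` is never
  unique (landed `KerrTimeTranslation`); so neither `∃! (M, a)` nor `∃! Ψ` strengthenings hold.
* **(c) Junk survey** (`junk_survey`): Minkowski (¬`IsConnected horizon`, F2); extremal Kerr (¬collar,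
  F4); super-extremal / negative-mass Kerr–Schild charts (no horizon); `t*`-periodic or `ℤ_k`-axial
  quotients (¬simply connected / ¬GH / conical axis); carved d.o.c. `Kerr ∖ (ℝ × B̄)` (¬`I⁺`-regular:
  causal diamonds through the removed tube are not compact, and NO hypersurface `S` with
  `S̄ = compact ∪ end`, `∂S̄ ⊆ 𝓔⁺` exists — `[𝓔⁺ ∩ S̄] − [S²_∞] = −[∂B] ≠ 0` in `H₂`); carved interior
  (invisible: conclusion is doc-only and TRUE); Kerr–NUT / C-metric / Tomimatsu–Sato δ=2 /
  double-Kerr / Weyl strut solutions (AF `S²`-end, Ricci-flatness, GH, connected horizon or regular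
  axis fail); time-reversed presentations (`𝓔⁺ = ∅` in the ingoing chart, or Kerr with `a ↦ −a`);
  rescaled `T` (absorbed, F5(iv)).  None passes all hypotheses with a non-Kerr d.o.c.
* **(d) Targets**: none (`payload.targets = []`, no line picked yet).
* **(e) Near-misses** (sorried): `false_without_collarTimelike` (extremal Kerr),
  `false_without_iPlusRegular` (carved d.o.c.).  NOT claimed: without-`Extends` (= smooth stationary
  no-hair in the collar telescope: OPEN, believed TRUE — the AIK conjecture), without-`FuturePresented`,
  without-`SimplyConnected` (both believed redundant).

## References

Chruściel–Costa, Astérisque 321 (2008) = arXiv:0806.0016, Thm 1.3, Rem 1.6, Cor 3.8, §5 Thm 5.4–5.6;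
Chruściel–Costa–Heusler, Living Rev. Rel. 15 (2012) 7, §3; Beig–Chruściel, CMP 188 (1997) 585;
Chruściel, CQG 10 (1993) 2091 (gr-qc/9304029); Dafermos–Rodnianski–Shlapentokh-Rothman,
arXiv:1402.7034 Lemma 4.7.2; Kunduri–Lucietti, Living Rev. Rel. 16 (2013) 8 (vacuum near-horizon
equations); Chruściel–Wald, CQG 11 (1994) L147; Sbierski, JDG 108 (2018).
-/

noncomputable section

namespace Summit.FinalStateConjecture.FinalStateConjecture.Cruxes.HawkingExtensionIsKerr.Disproof

open Set Function Literature.Geometry.Lorentzian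
open scoped Manifold ContDiff Topology
open Summit.FinalStateConjecture.FinalStateConjecture.Theses.ZeroEnergyKerrOrBomb (HawkingExtensionIsKerr)
open Summit.FinalStateConjecture.FinalStateConjecture.Theorems.ZeroEnergyRigidity.Negative

/-! ## (F0) The telescope, with named hypotheses -/

section Named

variable (𝓑 : StationaryAFBlackHole.{0})

/-- h-vac: `𝓑` is vacuum. [folklore] -/
def Vacuum [𝓑.metric.HasLeviCivita] : Prop := 𝓑.metric.toPseudoRiemannianMetric.IsRicciFlat

/-- h-fut: every event lies in `I⁺(M_ext)` (future-presented). [folklore] -/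
def FuturePresented : Prop :=
  ∀ p : 𝓑.carrier, p ∈ 𝓑.metric.chronologicalFuture 𝓑.timeOrientation 𝓑.Mext

/-- h-T: `T ≠ 0` on the d.o.c. (REDUNDANT given `IsIPlusRegular`, F3). [folklore] -/
def KillingNonvanishing : Prop := ∀ p ∈ 𝓑.doc, 𝓑.killing p ≠ 0

variable (U : Set 𝓑.carrier) (K : Π x : 𝓑.carrier, TangentSpace (𝓡 4) x)

/-- collar (1): `K` is smooth on `U`. [folklore] -/
def CollarSmooth : Prop :=
  ContMDiffOn (𝓡 4) ((𝓡 4).prod 𝓘(ℝ, E4)) ((⊤ : ℕ∞) : WithTop ℕ∞)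
    (fun x ↦ (Bundle.TotalSpace.mk' E4 x (K x) : TangentBundle (𝓡 4) 𝓑.carrier)) U

/-- collar (2): `K` satisfies the Killing equation on `U`. [folklore] -/
def CollarKilling [𝓑.metric.HasLeviCivita] : Prop :=
  ∀ x ∈ U, ∀ v w : TangentSpace (𝓡 4) x, 𝓑.metric.val x (𝓑.metric.leviCivita K x v) w +
    𝓑.metric.val x v (𝓑.metric.leviCivita K x w) = 0

/-- collar (3): `[T, K] = 0` on `U`. [folklore] -/
def CollarCommutes : Prop := ∀ x ∈ U, VectorField.mlieBracket (𝓡 4) 𝓑.killing K x = 0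

/-- collar (4): `K ≠ 0` on `𝓔⁺`. [folklore] -/
def CollarNonvanishing : Prop := ∀ p ∈ 𝓑.horizon, K p ≠ 0

/-- collar (5): `K` is tangent to `𝓔⁺` — through GLOBAL integral curves only (F5(i)). [folklore] -/
def CollarTangent : Prop :=
  ∀ γ : ℝ → 𝓑.carrier, IsMIntegralCurve γ K → γ 0 ∈ 𝓑.horizon → ∀ t, γ t ∈ 𝓑.horizon

/-- collar (6): `K` is timelike on `U ∩ doc` (LOAD-BEARING for sub-extremality, F4). [folklore] -/
def CollarTimelike : Prop := ∀ x ∈ U ∩ 𝓑.doc, 𝓑.metric.val x (K x) (K x) < 0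

/-- h-ext: the collar field extends to a `T`-commuting Killing field of the d.o.c. (doc level only,
F5(ii)). [folklore] -/
def Extends [𝓑.metric.HasLeviCivita] : Prop :=
  ∃ K' : Π x : 𝓑.carrier, TangentSpace (𝓡 4) x,
    ContMDiffOn (𝓡 4) ((𝓡 4).prod 𝓘(ℝ, E4)) ((⊤ : ℕ∞) : WithTop ℕ∞)
      (fun x ↦ (Bundle.TotalSpace.mk' E4 x (K' x) : TangentBundle (𝓡 4) 𝓑.carrier)) 𝓑.doc ∧
    (∀ x ∈ 𝓑.doc, ∀ v w : TangentSpace (𝓡 4) x,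
      𝓑.metric.val x (𝓑.metric.leviCivita K' x v) w +
        𝓑.metric.val x v (𝓑.metric.leviCivita K' x w) = 0) ∧
    (∀ x ∈ 𝓑.doc, VectorField.mlieBracket (𝓡 4) 𝓑.killing K' x = 0) ∧
    ∃ U' : Set 𝓑.carrier, IsOpen U' ∧ 𝓑.horizon ⊆ U' ∧ ∀ x ∈ U' ∩ 𝓑.doc, K' x = K x

/-- The conclusion: the d.o.c. is a sub-extremal Kerr exterior (chart form; verbatim the conclusion
of `ZeroEnergyRigidity`/`KerrOrBomb`). [folklore] -/
def KerrConclusion [Kerr.Facts] : Prop :=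
  ∃ (M a : ℝ), Kerr.IsSubextremal M a ∧ ∃ Ψ : Kerr.exterior M a → 𝓑.carrier,
    Function.Injective Ψ ∧ Set.range Ψ = 𝓑.doc ∧
      PseudoRiemannianMetric.IsIsometricImmersion
        (Kerr.smoothMetric M a (Kerr.rPlus M a)).toPseudoRiemannianMetric
        𝓑.metric.toPseudoRiemannianMetric Ψ

end Named

/-- **(F0)** The served crux, hypotheses named (definitional unfolding only). [folklore] -/
theorem hawkingExtensionIsKerr_iff_named :
    HawkingExtensionIsKerr ↔
      ∀ (𝓑 : StationaryAFBlackHole.{0}) [𝓑.metric.HasLeviCivita] [Kerr.Facts],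
        Vacuum 𝓑 → 𝓑.IsIPlusRegular → FuturePresented 𝓑 → KillingNonvanishing 𝓑 →
        SimplyConnectedSpace 𝓑.doc →
        ∀ (U : Set 𝓑.carrier) (K : Π x : 𝓑.carrier, TangentSpace (𝓡 4) x),
          IsOpen U → 𝓑.horizon ⊆ U → IsConnected 𝓑.horizon →
          CollarSmooth 𝓑 U K → CollarKilling 𝓑 U K → CollarCommutes 𝓑 U K →
          CollarNonvanishing 𝓑 K → CollarTangent 𝓑 K → CollarTimelike 𝓑 U K → Extends 𝓑 K →
          KerrConclusion 𝓑 :=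
  Iff.rfl

/-! ## (a) Load-bearing analysis -/

section LoadBearing

/-! ### (F2) `IsConnected 𝓑.horizon` — load-bearing (Minkowski).  LANDED: p134444. -/

/-- The crux with the binder `IsConnected 𝓑.horizon →` deleted, rest verbatim. [folklore] -/
def WithoutConnectedHorizon : Prop :=
  ∀ (𝓑 : StationaryAFBlackHole.{0}) [𝓑.metric.HasLeviCivita] [Kerr.Facts],
    Vacuum 𝓑 → 𝓑.IsIPlusRegular → FuturePresented 𝓑 → KillingNonvanishing 𝓑 →
    SimplyConnectedSpace 𝓑.doc →
    ∀ (U : Set 𝓑.carrier) (K : Π x : 𝓑.carrier, TangentSpace (𝓡 4) x),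
      IsOpen U → 𝓑.horizon ⊆ U →
      CollarSmooth 𝓑 U K → CollarKilling 𝓑 U K → CollarCommutes 𝓑 U K →
      CollarNonvanishing 𝓑 K → CollarTangent 𝓑 K → CollarTimelike 𝓑 U K → Extends 𝓑 K →
      KerrConclusion 𝓑

/-- **(F2) Any proof must use `IsConnected 𝓑.horizon`** — the landed theorem
`…Negative.hawkingExtensionIsKerr_false_without_connectedHorizon` (p134444), restated for the named
telescope (definitional unfolding).  Witness `minkowskiBH`, void collar `U := ∅`, `K := 0`,
extension `K' := ∂ₜ`. [cite: SbierskiJDG2018, Thm. 1] -/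
theorem false_without_connectedHorizon : ¬ WithoutConnectedHorizon :=
  Theorems.HawkingExtensionIsKerr.Negative.hawkingExtensionIsKerr_false_without_connectedHorizon

/-- The hypotheses other than `IsConnected 𝓑.horizon` are jointly satisfiable with EMPTY horizon and
failing conclusion (landed `exists_presentation_empty_horizon_extension_not_kerr`). [folklore] -/
theorem exists_presentation_empty_horizon :
    ∃ (𝓑 : StationaryAFBlackHole.{0}) (_ : 𝓑.metric.HasLeviCivita) (_ : Kerr.Facts),
      𝓑.horizon = ∅ ∧ Vacuum 𝓑 ∧ 𝓑.IsIPlusRegular ∧ FuturePresented 𝓑 ∧ KillingNonvanishing 𝓑 ∧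
      SimplyConnectedSpace 𝓑.doc ∧ ¬ KerrConclusion 𝓑 :=
  Theorems.HawkingExtensionIsKerr.Negative.exists_presentation_empty_horizon_extension_not_kerr

/-! ### (F3) `KillingNonvanishing` — redundant.  LANDED with p134444. -/

/-- **(F3)** The crux is equivalent to itself with `KillingNonvanishing 𝓑 →` deleted
(Chruściel–Costa 2008 Cor. 3.8, `I⁺`-regular form, a tree theorem). [cite: ChruscielCosta2008, Cor. 3.8] -/
theorem iff_without_killingNonvanishing :
    HawkingExtensionIsKerr ↔
      ∀ (𝓑 : StationaryAFBlackHole.{0}) [𝓑.metric.HasLeviCivita] [Kerr.Facts],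
        Vacuum 𝓑 → 𝓑.IsIPlusRegular → FuturePresented 𝓑 → SimplyConnectedSpace 𝓑.doc →
        ∀ (U : Set 𝓑.carrier) (K : Π x : 𝓑.carrier, TangentSpace (𝓡 4) x),
          IsOpen U → 𝓑.horizon ⊆ U → IsConnected 𝓑.horizon →
          CollarSmooth 𝓑 U K → CollarKilling 𝓑 U K → CollarCommutes 𝓑 U K →
          CollarNonvanishing 𝓑 K → CollarTangent 𝓑 K → CollarTimelike 𝓑 U K → Extends 𝓑 K →
          KerrConclusion 𝓑 :=
  Theorems.HawkingExtensionIsKerr.Negative.hawkingExtensionIsKerr_iff_without_killingNonvanishing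

/-! ### (F4)/(F4′) `CollarTimelike` — the guard against the degenerate case (extremal Kerr).
LANDED (chart-level certificates): p134595 (`ExtremalKerrNoCollar`), p135001 (`HorizonCombination`). -/

open Kerr in
/-- **(F4) closed form** (landed `bilin_hawkingVector_extremal_equatorial`): at `a = M > 0`, on the
equator `x₃ = 0`, `g(K,K) = (r − M)²(r + 2M)/(4M²r)` for the Hawking field `K = T + Φ/(2M)`. [folklore] -/
theorem extremal_equatorial_closed_form {M : ℝ} (hM : 0 < M) {x : E4} (hx3 : x 3 = 0)
    (hr : 0 < radius M x) :
    bilin M M x (hawkingVector M M x) (hawkingVector M M x) =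
      (radius M x - M) ^ 2 * (radius M x + 2 * M) / (4 * M ^ 2 * radius M x) :=
  Theorems.HawkingExtensionIsKerr.Negative.bilin_hawkingVector_extremal_equatorial hM hx3 hr

open Kerr in
/-- **(F4′) on the horizon** (landed `bilin_stationary_add_smul_axial_on_horizon`):
`g(T + cΦ, T + cΦ)|_{r = r₊} = σ (c(r₊² + a²) − a)²/ρ²`, `|a| ≤ M`, `M > 0`. [folklore] -/
theorem horizon_combination_closed_form {M a : ℝ} (h : |a| ≤ M) (hM : 0 < M) (c : ℝ) {x : E4}
    (hx : radius a x = rPlus M a) :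
    bilin M a x (E4.basisVector 0 + c • axialVector x) (E4.basisVector 0 + c • axialVector x) =
      (rPlus M a ^ 2 - x 3 ^ 2) / rPlus M a ^ 2 * (c * (rPlus M a ^ 2 + a ^ 2) - a) ^ 2 /
        (rPlus M a ^ 2 + a ^ 2 * (1 - (rPlus M a ^ 2 - x 3 ^ 2) / rPlus M a ^ 2)) :=
  Theorems.HawkingExtensionIsKerr.Negative.bilin_stationary_add_smul_axial_on_horizon h hM c hx

open Kerr in
/-- **(F4′) only the generator can have a collar**: `c ≠ ω₊` ⇒ no radial timelike collar for
`T + cΦ`, every `|a| ≤ M` (landed `not_exists_collar_of_ne_horizonAngularVelocity`). [folklore] -/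
theorem no_collar_of_ne_generator {M a c : ℝ} (h : |a| ≤ M) (hM : 0 < M)
    (hc : c ≠ horizonAngularVelocity M a) :
    ¬ ∃ ε₀ : ℝ, 0 < ε₀ ∧ ∀ x : E4, rPlus M a < radius a x → radius a x < rPlus M a + ε₀ →
        bilin M a x (E4.basisVector 0 + c • axialVector x) (E4.basisVector 0 + c • axialVector x) < 0 :=
  Theorems.HawkingExtensionIsKerr.Negative.not_exists_collar_of_ne_horizonAngularVelocity h hM hc

open Kerr in
/-- **(F4) + (F4′): at `a = M` NO `T + cΦ` has a Killing–timelike collar** (landed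
`not_exists_collar_extremal`), whereas for `|a| < M` the Hawking field does (tree
`Kerr.exists_bilin_hawkingVector_neg`): sub-extremal ⇔ collar, for the Kerr family. [folklore] -/
theorem no_collar_extremal {M : ℝ} (hM : 0 < M) (c : ℝ) :
    ¬ ∃ ε₀ : ℝ, 0 < ε₀ ∧ ∀ x : E4, rPlus M M < radius M x → radius M x < rPlus M M + ε₀ →
        bilin M M x (E4.basisVector 0 + c • axialVector x) (E4.basisVector 0 + c • axialVector x) < 0 :=
  Theorems.HawkingExtensionIsKerr.Negative.not_exists_collar_extremal hM c

open Kerr in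
/-- For contrast (tree, DRSR Lemma 4.7.2): for `|a| < M` the Hawking field HAS a collar. [cite: DafermosRodnianskiShlapentokhrothman2014, Lemma 4.7.2] -/
theorem collar_subextremal {M a : ℝ} (hMa : IsSubextremal M a) :
    ∃ ε₀ : ℝ, 0 < ε₀ ∧ ∀ x : E4, rPlus M a < radius a x → radius a x < rPlus M a + ε₀ →
      bilin M a x (hawkingVector M a x) (hawkingVector M a x) < 0 :=
  exists_bilin_hawkingVector_neg hMa

/-! ### (F4″) Axis anatomy of the collar failure at `a = M` (session B).  LANDED: p134796.

On the axis the whole Killing span reduces to `T`; at `a = M` the Hawking field is timelike on the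
axis off `{r = M}` — complementary to the spacelike equator of (F4). -/

/-- Kernel link to the landed `bilin_killingSpan_axis` (p134796): on the rotation axis
`{x₁ = x₂ = 0}`, `r > 0`, `g_{M,a}(T + cΦ, T + cΦ) = −(r² − 2Mr + a²)/(r² + a²)` for all real
`M, a, c`. [cite: ONeill1995, Ch. 2 §2.4] -/
theorem killingSpan_axis_closed_form (M a c : ℝ) {x : E4} (hx1 : x 1 = 0) (hx2 : x 2 = 0)
    (hr : 0 < Kerr.radius a x) :
    Kerr.bilin M a x (E4.basisVector 0 + c • Kerr.axialVector x)
        (E4.basisVector 0 + c • Kerr.axialVector x) =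
      -(Kerr.radius a x ^ 2 - 2 * M * Kerr.radius a x + a ^ 2) / (Kerr.radius a x ^ 2 + a ^ 2) :=
  Summit.FinalStateConjecture.FinalStateConjecture.Theorems.HawkingExtensionIsKerr.Negative.bilin_killingSpan_axis
    M a c hx1 hx2 hr

/-- Kernel link to the landed `bilin_hawkingVector_extremal_axis` (p134796): at `a = M`, on the axis,
`g_{M,M}(K, K) = −(r − M)²/(r² + M²)` for the Hawking field `K = T + Φ/(2M)`. [cite: ONeill1995, Ch. 2 §2.4] -/
theorem extremal_axis_closed_form (M : ℝ) {x : E4} (hx1 : x 1 = 0) (hx2 : x 2 = 0)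
    (hr : 0 < Kerr.radius M x) :
    Kerr.bilin M M x (Kerr.hawkingVector M M x) (Kerr.hawkingVector M M x) =
      -(Kerr.radius M x - M) ^ 2 / (Kerr.radius M x ^ 2 + M ^ 2) :=
  Summit.FinalStateConjecture.FinalStateConjecture.Theorems.HawkingExtensionIsKerr.Negative.bilin_hawkingVector_extremal_axis
    M hx1 hx2 hr

/-- Kernel link to the landed `bilin_hawkingVector_extremal_axis_neg` (p134796): at `a = M` the
Hawking field is TIMELIKE at every axis point off the horizon (`r > 0`, `r ≠ M`) — the polar caps
carry a two-sided Killing–timelike collar, so the failure of `CollarTimelike` on extremal Kerr (F4)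
is invisible on the axis. [cite: ONeill1995, Ch. 2 §2.4] -/
theorem extremal_axis_timelike (M : ℝ) {x : E4} (hx1 : x 1 = 0) (hx2 : x 2 = 0)
    (hr : 0 < Kerr.radius M x) (hrM : Kerr.radius M x ≠ M) :
    Kerr.bilin M M x (Kerr.hawkingVector M M x) (Kerr.hawkingVector M M x) < 0 :=
  Summit.FinalStateConjecture.FinalStateConjecture.Theorems.HawkingExtensionIsKerr.Negative.bilin_hawkingVector_extremal_axis_neg
    M hx1 hx2 hr hrM

end LoadBearing

/-! ## (b) Tightness of the conclusion (inherited from the landed `KerrParameterSign`) -/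

/-- `KerrConclusion 𝓑` is the `KerrExteriorPresentation` form (`Iff.rfl`). [folklore] -/
theorem kerrConclusion_iff_exists_presentation (𝓑 : StationaryAFBlackHole.{0}) [Kerr.Facts] :
    KerrConclusion 𝓑 ↔ ∃ M a : ℝ, Kerr.IsSubextremal M a ∧ KerrExteriorPresentation 𝓑 M a :=
  Iff.rfl

/-- **(b)** Normal form of the conclusion: the spin may be taken `0 ≤ a` (so `∃! (M, a)` is false
for rotating presentations and a proof must fix the sign by an orientation convention). [folklore] -/
theorem kerrConclusion_iff_nonneg_spin (𝓑 : StationaryAFBlackHole.{0}) [Kerr.Facts] :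
    KerrConclusion 𝓑 ↔
      ∃ M a : ℝ, Kerr.IsSubextremal M a ∧ 0 ≤ a ∧ KerrExteriorPresentation 𝓑 M a :=
  exists_kerrExteriorPresentation_iff_nonneg 𝓑

/-! ## (c) Junk survey and pre-triage (prose) -/

/-- **(c) Junk survey.**  Presentations tried against the telescope (hypothesis that kills each):
* Minkowski `minkowskiBH` — `IsConnected horizon` (horizon empty); everything else passes (F2).
* Extremal Kerr `a = M` — `CollarTimelike` (F4); everything else passes on paper; conclusion false
  on paper (`|a| < M`).
* Super-extremal `|a| > M` / `M ≤ 0` Kerr–Schild charts — no horizon (`IsConnected`).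
* `t*`-periodic quotient Kerr/ℤ — `SimplyConnectedSpace doc` (π₁ = ℤ) and ¬GH (closed timelike
  `T`-orbits… in fact CTCs through the doc: ¬`I⁺`-regular).
* `ℤ_k` axial quotient / cosmic-string Kerr (conical axis removed) — AF `S²` end of the structure,
  `SimplyConnectedSpace doc`, GH of doc.
* Carved d.o.c. `Kerr ∖ (ℝ × B̄)` — ¬`I⁺`-regular (non-compact diamonds; homological obstruction to
  the hypersurface `S̄ = compact ∪ end` with `∂S̄ ⊆ 𝓔⁺`); conclusion would indeed FAIL there (an
  injective local isometry of a full Kerr exterior into Kerr is onto, by analytic rigidity).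
* Carved interior / glued different interior — invisible (conclusion doc-only, TRUE).
* Kruskal-type (white hole present) — only `FuturePresented` fails; conclusion TRUE.
* Kerr–NUT (Misner string / periodic time), C-metric (conical, accelerated end), Tomimatsu–Sato
  δ = 2 (naked ring + CTC region: ¬GH), double-Kerr / Weyl multi-rod (struts; disconnected horizon),
  Kerr–Newman (¬Ricci-flat).
* Rescaled `T ↦ cT` and time-reversed presentations — absorbed (F5(iv)); `a ↦ −a` (b).
None passes all hypotheses with a non-Kerr d.o.c. [folklore] -/
theorem junk_survey : True := trivial

/-- **Pre-triage of the ideator stubs** (`Cruxes/HawkingExtensionIsKerr/SketchIdeator2.lean`), cheap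
attacks only, no kill:
* `CollarSandwich` — TRUE-looking: `I^±(M_ext) = I^±(T·y)` for any `y ∈ M_ext` + flow invariance of
  `≪`; note it needs `N` invariant under ALL integral curves of `T` (as typed) — fine since `T` is
  complete.
* `KillingSandwichCompleteness` — plausible (Chruściel 1997 sandwich with compact anchors): the local
  `Z`-flow maps the causal curve `C₁ → p → C₂` to causal curves between `C₁` and `C₂`, confining the
  orbit of `p` to the compact diamond `J⁺(C₁) ∩ J⁻(C₂) ⊆ doc`; needs the flow defined uniformly along
  a compact causal curve (ok) and `J⁺(compact) ∩ J⁻(compact)` compact in a GH SET (Hawking–Ellis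
  §6.6 gives points; compact sets by a finite cover argument — check the tree has it).
* `DocAxisymmetryFromExtension` — the real content (Beig–Chruściel at doc level); no counterexample
  known; mind F5(iv): `Ω` is only defined after normalising `T`, but the stub quantifies `∃ c Ω`, ok.
* `DegenerateGeneratorTurnsSpacelike` — TRUE on extremal Kerr (F4: the equator); mechanism
  `∫_{S²} F = 8π` checked against `F = ½|h|² − ½ div h` (Kunduri–Lucietti vacuum NH equation): both
  give `∫F = ½∫|h|² = 4πχ`.  Its hypothesis list asks `K` null on `𝓔⁺` AND `∇_K K = 0` on `𝓔⁺` —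
  consistent.  Caveat: it silently needs `𝓔⁺` to be a smooth Killing horizon of `K` with compact
  `S²` sections (CC08 Thm 4.11 + Cor 4.6 under `I⁺`-regularity) — state that as an input.
[folklore] -/
theorem pretriage_ideator_stubs : True := trivial

/-! ## (d) Targets — none this cycle (`payload.targets = []`). -/

/-! ## (e) Near-misses (sorried; witness + obstruction in the docstring) -/

section NearMisses

/-- The crux with `CollarTimelike 𝓑 U K →` deleted. [folklore] -/
def WithoutCollarTimelike : Prop :=
  ∀ (𝓑 : StationaryAFBlackHole.{0}) [𝓑.metric.HasLeviCivita] [Kerr.Facts],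
    Vacuum 𝓑 → 𝓑.IsIPlusRegular → FuturePresented 𝓑 → KillingNonvanishing 𝓑 →
    SimplyConnectedSpace 𝓑.doc →
    ∀ (U : Set 𝓑.carrier) (K : Π x : 𝓑.carrier, TangentSpace (𝓡 4) x),
      IsOpen U → 𝓑.horizon ⊆ U → IsConnected 𝓑.horizon →
      CollarSmooth 𝓑 U K → CollarKilling 𝓑 U K → CollarCommutes 𝓑 U K →
      CollarNonvanishing 𝓑 K → CollarTangent 𝓑 K → Extends 𝓑 K →
      KerrConclusion 𝓑

/-- **Near-miss (F4)**: WITNESS extremal Kerr `a = M` in ingoing Kerr–Schild coordinates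
`{r > M − δ}` with `K = K' = T + Φ/(2M)` (Killing, tangent, non-vanishing, commuting, extends
globally), vacuum, `I⁺`-regular (CC08: "all those conditions are satisfied by … Kerr"), future-
presented, simply connected d.o.c., connected horizon `ℝ × S²`; its d.o.c. is not a SUB-extremal
Kerr exterior.  OBSTRUCTION: (1) no `StationaryAFBlackHole` packaging of extremal Kerr in the tree
(the sub-extremal `Kerr.stationaryAFBlackHoleOn` needs `|a| < M` for its slice facts);
(2) non-isometry of `Kerr(M, M)` and `Kerr(M', a')`, `|a'| < M'`, exteriors needs curvature
invariants / asymptotics in Lean.  The chart-level certificate that the collar FAILS there is F4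
(landed p134595). [folklore] -/
theorem false_without_collarTimelike : ¬ WithoutCollarTimelike := by
  sorry

/-- The crux with `𝓑.IsIPlusRegular →` deleted. [folklore] -/
def WithoutIPlusRegular : Prop :=
  ∀ (𝓑 : StationaryAFBlackHole.{0}) [𝓑.metric.HasLeviCivita] [Kerr.Facts],
    Vacuum 𝓑 → FuturePresented 𝓑 → KillingNonvanishing 𝓑 → SimplyConnectedSpace 𝓑.doc →
    ∀ (U : Set 𝓑.carrier) (K : Π x : 𝓑.carrier, TangentSpace (𝓡 4) x),
      IsOpen U → 𝓑.horizon ⊆ U → IsConnected 𝓑.horizon →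
      CollarSmooth 𝓑 U K → CollarKilling 𝓑 U K → CollarCommutes 𝓑 U K →
      CollarNonvanishing 𝓑 K → CollarTangent 𝓑 K → CollarTimelike 𝓑 U K → Extends 𝓑 K →
      KerrConclusion 𝓑

/-- **Near-miss**: WITNESS the carved presentation `Kerr(M, a) ∖ (ℝ × B̄)`, `|a| < M`, `B̄` a small
closed ball of the `t* = 0` slice inside the exterior, off the axis and off the collar: `T` stays
complete (the tube is `T`-invariant), the AF end, vacuum, future-presentedness, `T ≠ 0`, the collar
`(U, T + ω₊Φ)` and the global extension survive, `doc = {r > r₊} ∖ tube` is simply connected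
(`ℝ³` minus two balls) with connected horizon; the conclusion FAILS (an injective isometric
immersion of a full Kerr exterior into a Kerr exterior is a restriction of a global isometry by
analyticity + the 2-dimensional Killing algebra, hence onto).  OBSTRUCTION: the non-surjectivity
argument (analytic rigidity of local isometries of Kerr) is far from the tree; and the point is moot —
`I⁺`-regularity is exactly what excludes the witness (GH of the d.o.c. fails through the tube). [folklore] -/
theorem false_without_iPlusRegular : ¬ WithoutIPlusRegular := by
  sorry

/-- The crux with `Extends 𝓑 K →` deleted = smooth stationary vacuum no-hair in the collar telescope
(every hole of the telescope is Kerr).  STATUS: OPEN and believed TRUE (Alexakis–Ionescu–Klainerman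
conjecture; Chruściel–Costa Conjecture 1.2); NOT a near-miss — nothing is claimed. [folklore] -/
def WithoutExtends : Prop :=
  ∀ (𝓑 : StationaryAFBlackHole.{0}) [𝓑.metric.HasLeviCivita] [Kerr.Facts],
    Vacuum 𝓑 → 𝓑.IsIPlusRegular → FuturePresented 𝓑 → KillingNonvanishing 𝓑 →
    SimplyConnectedSpace 𝓑.doc →
    ∀ (U : Set 𝓑.carrier) (K : Π x : 𝓑.carrier, TangentSpace (𝓡 4) x),
      IsOpen U → 𝓑.horizon ⊆ U → IsConnected 𝓑.horizon →
      CollarSmooth 𝓑 U K → CollarKilling 𝓑 U K → CollarCommutes 𝓑 U K →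
      CollarNonvanishing 𝓑 K → CollarTangent 𝓑 K → CollarTimelike 𝓑 U K →
      KerrConclusion 𝓑

-- (`WithoutExtends → HawkingExtensionIsKerr` is immediate monotonicity; not recorded as a theorem to keep
-- this work file free of positive statements about the Theses decl.)

end NearMisses

end Summit.FinalStateConjecture.FinalStateConjecture.Cruxes.HawkingExtensionIsKerr.Disproof

end
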